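import Summits.MatrixMultiplication.OmegaCensus.STPP222NeverBeatsCore
import Summits.MatrixMultiplication.OmegaCensus.STPPSumsetPacking
import Summits.MatrixMultiplication.OmegaCensus.STPP222SqNoneBelow24

/-!
# ω-census, THE CUBE NON-BEATING THEOREM: `(2,2,2)^k ⊆ H` forces `8k ≤ |H|` — k simultaneous `⟨2,2,2⟩` never beat the sum of cubes

HONEST FRAMING (pub-omega census; verbatim): lottery ticket; floor = certified bounds/negative ranges.
Census STRUCTURE (seat pub-omega-stpp-1 gen 24, 2026-08-27; STRUCTURE.md column B3 "k simultaneous ⟨2,2,2⟩: no law, the wall is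
search volume", null N1, question Q7).  Nothing here is progress on `ω`; on the contrary, the theorem says that one whole
construction class can NEVER give a bound below `3`.

## Statement

**`eight_mul_le_card`.**  Let `H` be a finite abelian group and `(Aᵢ, Bᵢ, Cᵢ)_{i<k}` an STPP family (CKSU 2005 Def. 5.1, tree
`IsSTPP`) with `|Aᵢ| = |Bᵢ| = |Cᵢ| = 2` for all `i`.  Then `8k ≤ |H|`.

**`sum_volume_le_card`.**  Consequently `Σᵢ |Aᵢ||Bᵢ||Cᵢ| = 8k ≤ |H| = Σ_χ d_χ³`: a family of `k` simultaneous `⟨2,2,2⟩` TPP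
triples never "beats the sum of cubes" in ANY finite abelian group, at ANY order, for ANY `k` — so CKSU Thm 5.5 / Cor 5.6 applied to
such a family yields no bound `ω < 3` (the pure-cube class of the census predicate `NO_BEATING_STPP` is settled for all abelian
groups at once; the engines may drop it).  `eight_mul_le_of_zmod` is the `ℤ/mℤ` form.

Before this file the kernel had the packing bound `8k − 4 ≤ |H|` (`card_ge_of_isSTPP_222pow`, `STPP222PowCyclic.lean`), leaving
exactly the four orders `8k − 4, …, 8k − 1` per `k` in which a beating cube family was not excluded by a theorem (only by the
finite census for `k ≤ 5`).

## Proof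

`k ≤ 2`: the tree's volume bound (`stpp_card_mul_card_mul_card_le`, `k = 1`) and `not_exists_isSTPP_222sq_of_card_le`
(`k = 2`: no abelian group of order `≤ 23` hosts `(2,2,2)²`).  `k ≥ 3`, `m = 4k`: the sets `X = ⋃(Bᵢ − Aᵢ)`, `Y = ⋃(Cᵢ − Bᵢ)`,
`Z = ⋃(Cᵢ − Aᵢ)` have `m` elements each and every `z ∈ Z` has EXACTLY two representations `z = x + y`
(`rep_eq_card_B`: they are `x = b − a'`, `b ∈ B_j`).  The abstract theorem `two_mul_le_card` then gives `|H| ≥ 2m`: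
Steps 0/A/B of `STPP222NeverBeatsCore.lean` reduce to `|H| = 2m − 1` with a set `T`, `#T ≥ m − 3`, whose difference set
`E = T − T` consists of near-periods of `Y` (`dif Y δ ≥ m − 2`) and has `#E ≤ m + 1`; Kneser's theorem (tree
`Literature.Combinatorics.Additive.add_kneser`, weak form) gives `2#T ≤ #E + #K` for the stabilizer `K = Stab(E) ⊆ E`, so
`#K ≥ m − 7`; the pair count `N_K = Σ_{κ∈K} dif Y κ ≥ m + (#K − 1)(m − 2)` is on the other hand `Σ_{y ∈ Y}`(size of the
`K`-fibre of `y`): if `#K = |H|` this is `≤ m²`, contradiction for `m ≥ 5`; otherwise `#K ≤ |H|/3` (odd order), forcing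
`m ≤ 20`, and `#K ∣ 2m − 1` leaves only `(m, #K) = (20, 13)`, killed by the fibre bound (`M ≤ 13`: at most `218 < 236`).

NOT claimed: anything about mixed block sizes (CKSU's own constructions beat the sum of cubes with larger blocks), any value of
the threshold functions `n_k`, `N_k` beyond `n_k ≥ 8k`, anything on `ω`.

References: H. Cohn, R. Kleinberg, B. Szegedy, C. Umans, *Group-theoretic algorithms for matrix multiplication*, FOCS 2005
(arXiv:math/0511460), Def. 5.1, Thm. 5.5; M. Kneser, Math. Z. 58 (1953) 459–484.
Record: pub-omega HOME `pub-omega-stpp-1-g24/` (seat notes, `code/n9_filter.py`), STRUCTURE.md §1 B3 / §4 N1, Q7.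
-/

open Finset
open scoped Pointwise

namespace Summit.MatrixMultiplication.OmegaCensus.CubeNB

variable {H : Type*} [AddCommGroup H] [DecidableEq H]

/-! ## The abstract theorem: `#X = #Y = #Z = m`, two representations on `Z` ⇒ `|H| ≥ 2m` -/

section CoreThm

variable [Fintype H] {X Y Z : Finset H} {m : ℕ}

/-- **Core combinatorial theorem.**  `X, Y, Z ⊆ H` of size `m = 4k ≥ 12` with exactly two representations
`z = x + y` for every `z ∈ Z` force `|H| ≥ 2m`. [folklore] -/
theorem two_mul_le_card (hm12 : 12 ≤ m) (h4 : 4 ∣ m) (hX : #X = m) (hY : #Y = m) (hZ : #Z = m)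
    (hrep : ∀ z ∈ Z, rep X Y z = 2) : 2 * m ≤ Fintype.card H := by
  by_contra hlt
  have hZne : Z.Nonempty := card_pos.1 (by omega)
  have h0 := two_mul_le_card_add_two hX hY hZne hrep
  rcases (by omega : Fintype.card H = 2 * m - 2 ∨ Fintype.card H = 2 * m - 1) with hcard | hcard
  · exact card_ne_two_mul_sub_two (by omega) hX hY hZ hrep hcard
  -- `|H| = 2m - 1`
  set n := Fintype.card H with hn
  set T := nearFull X Y Z m with hTdef
  have hT3 : m ≤ #T + 3 := le_card_nearFull (by omega) hX hY hZ hrep hcard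
  have hTne : T.Nonempty := card_pos.1 (by omega)
  set E := T + -T with hEdef
  have hE0 : (0 : H) ∈ E := by
    obtain ⟨g, hg⟩ := hTne
    exact mem_add.2 ⟨g, hg, -g, Finset.neg_mem_neg hg, add_neg_cancel g⟩
  have hEne : E.Nonempty := ⟨0, hE0⟩
  have hEdif : ∀ δ ∈ E, m ≤ dif Y δ + 2 := fun δ hδ => le_dif_of_mem_E hX hY hδ
  have hEcard : #E ≤ m + 1 := card_E_le (by omega) hY hcard hE0 hEdif
  -- Kneser
  set K := E.addStab with hKdef
  have hkn := Literature.Combinatorics.Additive.card_add_card_le_card_add_add_card_addStab T (-T) hTne hTne.neg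
  rw [Finset.card_neg] at hkn
  change #T + #T ≤ #E + #K at hkn
  have hK7 : m ≤ #K + 7 := by omega
  have hKsubE : K ⊆ E := fun κ hκ => by
    have := (Finset.mem_addStab' hEne).1 hκ hE0
    rwa [vadd_eq_add, add_zero] at this
  have hK0 : (0 : H) ∈ K := Finset.zero_mem_addStab.2 hEne
  have hKdvd : #K ∣ n := hEne.card_addStab_dvd_card_univ
  have hKsub : ∀ a ∈ K, ∀ b ∈ K, a - b ∈ K := fun a ha b hb => sub_mem_addStab hEne ha hb
  -- the pair count `N_K = Σ_{κ ∈ K} dif Y κ ≥ m + (#K - 1)(m - 2)`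
  have hNlow : #(K.erase 0) * m ≤ ∑ κ ∈ K.erase 0, dif Y κ + 2 * #(K.erase 0) := by
    have h2 : ∑ κ ∈ K.erase 0, m ≤ ∑ κ ∈ K.erase 0, (dif Y κ + 2) :=
      sum_le_sum fun κ hκ => hEdif κ (hKsubE (mem_of_mem_erase hκ))
    rw [sum_add_distrib, sum_const, sum_const, smul_eq_mul, smul_eq_mul] at h2
    linarith
  have hNsplit := sum_erase_add K (fun κ => dif Y κ) hK0
  rw [dif_zero, hY] at hNsplit
  have hKe : #(K.erase 0) + 1 = #K := card_erase_add_one hK0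
  have hNfib := sum_dif_eq_sum_fibre K Y
  have hYne : Y.Nonempty := card_pos.1 (by omega)
  by_cases hKn : #K = n
  · -- `K = H`: `N_K ≤ m²`
    have hup : ∑ y ∈ Y, #(Y.filter fun y' => y - y' ∈ K) ≤ #Y * #Y := by
      rw [← smul_eq_mul]; exact sum_le_card_nsmul _ _ _ fun y _ => card_filter_le _ _
    rw [hY, ← hNfib] at hup
    rw [hKn] at hKe
    -- (2m-2)(m-2) ≤ m² - m
    obtain ⟨b, hb⟩ : ∃ b, m = b + 5 := ⟨m - 5, by omega⟩
    have hKe' : #(K.erase 0) = 2 * b + 8 := by omega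
    rw [hKe', hb] at hNlow
    rw [hb] at hup
    nlinarith
  · -- proper subgroup of an odd-order group: index ≥ 3
    have h3K : 3 * #K ≤ n := by
      obtain ⟨c, hc⟩ := hKdvd
      rcases c with _ | _ | _ | c
      · omega
      · simp at hc; omega
      · omega
      · nlinarith
    -- so `m ≤ 20`, hence `m ∈ {12, 16, 20}`
    have hm20 : m ≤ 20 := by omega
    have hm' : m = 12 ∨ m = 16 ∨ m = 20 := by omega
    -- `#K ∈ [m-7, (2m-1)/3]` and `#K ∣ 2m - 1`
    obtain ⟨c, hc⟩ := hKdvd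
    rcases hm' with rfl | rfl | rfl
    · -- n = 23, 5 ≤ #K ≤ 7
      have h1 : 5 ≤ #K := by omega
      have h2 : #K ≤ 7 := by omega
      interval_cases hK : #K <;> omega
    · have h1 : 9 ≤ #K := by omega
      have h2 : #K ≤ 10 := by omega
      interval_cases hK : #K <;> omega
    · -- n = 39, #K = 13: the fibre bound
      have h13 : #K = 13 := by
        have h1 : 13 ≤ #K := by omega
        have h2 : #K ≤ 13 := by omega
        omega
      obtain ⟨M, hMK, hMY, hfib⟩ := fibre_bound K Y hKsub hYne
      rw [h13] at hMK hKe
      rw [hY, ← hNfib] at hfib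
      rw [hY] at hMY
      have hKe' : #(K.erase 0) = 12 := by omega
      rw [hKe'] at hNlow
      interval_cases M <;> omega

end CoreThm

/-! ## The cube non-beating theorem -/

section STPP

open Literature.Computability.AlgebraicComplexity

/-- **THE CUBE NON-BEATING THEOREM.**  If a finite abelian group `H` carries `k` simultaneous-TPP triples of 2-subsets
(`IsSTPP A B C`, all `|Aᵢ| = |Bᵢ| = |Cᵢ| = 2`), then `8k ≤ |H|`.  [cite: CohnKleinbergSzegedyUmans2005, Def. 5.1] -/
theorem eight_mul_le_card [Fintype H] {k : ℕ} {A B C : Fin k → Finset H} (hS : IsSTPP A B C)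
    (hc : ∀ i, #(A i) = 2 ∧ #(B i) = 2 ∧ #(C i) = 2) : 8 * k ≤ Fintype.card H := by
  rcases Nat.lt_or_ge k 3 with hk | hk
  · obtain rfl | rfl | rfl : k = 0 ∨ k = 1 ∨ k = 2 := by omega
    · simp
    · have := stpp_card_mul_card_mul_card_le hS 0
      rw [(hc 0).1, (hc 0).2.1, (hc 0).2.2] at this; omega
    · have h := not_exists_isSTPP_222sq_of_card_le (G := H)
      rw [Nat.card_eq_fintype_card] at h
      by_contra hlt
      exact h (by omega) ⟨A, B, C, hS, hc⟩
  · have hA : ∀ i, (A i).Nonempty := fun i => card_pos.1 (by rw [(hc i).1]; norm_num)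
    have hB : ∀ i, (B i).Nonempty := fun i => card_pos.1 (by rw [(hc i).2.1]; norm_num)
    have hC : ∀ i, (C i).Nonempty := fun i => card_pos.1 (by rw [(hc i).2.2]; norm_num)
    have hX : #(STPPKneser.DU A B univ) = 4 * k := by
      rw [STPPKneser.card_DU_AB hS hC]; simp [hc]; ring
    have hY : #(STPPKneser.DU B C univ) = 4 * k := by
      rw [STPPKneser.card_DU_BC hS hA]; simp [hc]; ring
    have hZ : #(STPPKneser.DU A C univ) = 4 * k := by
      rw [STPPKneser.card_DU_AC hS hB]; simp [hc]; ring
    have hrep : ∀ z ∈ STPPKneser.DU A C univ, rep (STPPKneser.DU A B univ) (STPPKneser.DU B C univ) z = 2 := by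
      intro z hz
      obtain ⟨j, -, hz⟩ := mem_biUnion.1 hz
      rw [rep_eq_card_B hS hz, (hc j).2.1]
    have := two_mul_le_card (by omega) ⟨k, rfl⟩ hX hY hZ hrep
    omega

/-- **Corollary (never beats the sum of cubes).**  For a `(2,2,2)^k` STPP family in a finite abelian group `H`:
`Σᵢ |Aᵢ||Bᵢ||Cᵢ| ≤ |H| = Σ_χ d_χ³`, so CKSU Thm 5.5 / Cor 5.6 yields no bound `ω < 3` from it — in ANY abelian group.
[cite: CohnKleinbergSzegedyUmans2005, Def. 5.1] -/
theorem sum_volume_le_card [Fintype H] {k : ℕ} {A B C : Fin k → Finset H} (hS : IsSTPP A B C)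
    (hc : ∀ i, #(A i) = 2 ∧ #(B i) = 2 ∧ #(C i) = 2) :
    ∑ i, #(A i) * #(B i) * #(C i) ≤ Fintype.card H := by
  have h := eight_mul_le_card hS hc
  have : ∑ i, #(A i) * #(B i) * #(C i) = 8 * k := by simp [hc]; ring
  omega

/-- `ZMod` form: `(2,2,2)^k ⊆ ℤ/mℤ` (`m ≥ 1`) forces `8k ≤ m`. [cite: CohnKleinbergSzegedyUmans2005, Def. 5.1] -/
theorem eight_mul_le_of_zmod {m k : ℕ} [NeZero m] {A B C : Fin k → Finset (ZMod m)} (hS : IsSTPP A B C)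
    (hc : ∀ i, #(A i) = 2 ∧ #(B i) = 2 ∧ #(C i) = 2) : 8 * k ≤ m := by
  simpa [ZMod.card] using eight_mul_le_card hS hc

end STPP

end Summit.MatrixMultiplication.OmegaCensus.CubeNB
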